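import Literature.Computability.AlgebraicComplexity.GroupTheoreticMatMul
import Mathlib.Data.ZMod.Basic
import HarnessLib

/-!
# Local strong uniquely solvable puzzles and the STPP families they generate (Cohn–Kleinberg–Szegedy–Umans)

Topic `Computability/AlgebraicComplexity`, namespace `Literature.Computability.AlgebraicComplexity`.

H. Cohn, R. Kleinberg, B. Szegedy, C. Umans, *Group-theoretic algorithms for matrix
multiplication*, FOCS 2005, arXiv:math/0511460 (held corpus text `paper:arxiv-math_0511460`,
§6.1, chunk p0010), over the tree's simultaneous triple product property `IsSTPP`
(`GroupTheoreticMatMul.lean`, CKSU Def. 5.1 in additive form).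

* `IsLocalStrongUSP` — §6.1 (p. 10): "A local strong USP of width `k` is a subset
  `U ⊆ {1,2,3}^k` such that for each ordered triple `(u,v,w) ∈ U³`, with `u`, `v`, and `w` not all
  equal, there exists `i ∈ [k]` such that `(uᵢ,vᵢ,wᵢ)` is an element of
  `{(1,2,1),(1,2,2),(1,1,3),(1,3,3),(2,2,3),(3,2,3)}`."  Rendered for a family of rows
  `row : Fin L → Fin k → Fin 3` (symbols `1,2,3` coded `0,1,2`; "not all equal" on the indices —
  the pattern set contains no constant triple, so the condition forces `row` to be injective, i.e.
  the family IS a set of `L` rows), with the pattern set `localStrongUSPPatterns` = "exactly two of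
  `uᵢ = 1`, `vᵢ = 2`, `wᵢ = 3` hold". This is verbatim the hypothesis shape of route
  `Summits/MatrixMultiplication/MatrixMultiplication/Theses/ThinBlockAlpha.lean`, crux
  `SkewLocalStrongUSP`.
* `uspA`, `uspB`, `uspC` — the subsets of `Cyc_ℓ^k = Fin k → ZMod ℓ` of Theorem 33:
  "`A_u = {x ∈ Cyc_ℓ^k : x_j ≠ 0 iff u_j = 1}`, `B_u = {x : x_j ≠ 0 iff u_j = 2}`,
  `C_u = {x : x_j ≠ 0 iff u_j = 3}`."
* `CohnKleinbergSzegedyUmans2005_thm33` — **Theorem 33** (p. 10), AS PRINTED: "Let `U` be a local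
  strong USP of width `k`, and for each `u ∈ U` define subsets `A_u, B_u, C_u ⊆ Cyc_ℓ^k` by [the
  above]. Then the triples `A_u, B_u, C_u` satisfy the simultaneous triple product property."
  Named fact. (Printed proof, half a page: for `u, v, w` not all equal the USP coordinate `i` makes
  exactly one of the six group elements in the STPP relation nonzero at `i`, so the relation cannot
  hold; for `u = v = w` the three sets are supported on disjoint coordinate sets. Checked on paper
  against the tree's index convention of `IsSTPP` — quantifier pattern `s' ∈ A i, s ∈ A k,
  t' ∈ B j, t ∈ B i, u' ∈ C k, u ∈ C j`: at a coordinate `c` the number of nonzero terms is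
  `[i_c ∈ {1,2}] + [j_c ∈ {2,3}] + [k_c ∈ {1,3}]`, which equals `1` iff exactly two of
  `j_c = 1, k_c = 2, i_c = 3` hold, i.e. iff `(j,k,i)` hits the pattern set at `c` — the local
  strong USP condition for the ordered triple `(j,k,i)`; so the statement is true for the tree's
  `IsSTPP` exactly as for CKSU's Def. 5.1.) It grounds the support `USPToBounded`
  (`SkewLocalStrongUSP → BoundedExponentThird`, "CKSU Thm 33 at `ℓ = 7` plus counting") of route
  ThinBlockAlpha.

What is NOT here: strong USPs and USPs proper (CKSU Defs. 6.?/§3, Lemma 32 "every local strong USP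
is a strong USP"), the USP capacity (Thm. 6.? / Prop. 3.8), and the cardinality bookkeeping
`|A_u| = (ℓ-1)^{#1s}` etc. (elementary, left to the prover of `USPToBounded`).
-/

noncomputable section

namespace Literature.Computability.AlgebraicComplexity

open Finset

/-- The six admissible coordinate patterns of a local strong USP (CKSU §6.1), with the symbols
`1, 2, 3` coded `0, 1, 2`: `{(1,2,1),(1,2,2),(1,1,3),(1,3,3),(2,2,3),(3,2,3)}` — exactly the triples
`(a,b,c)` in which exactly two of `a = 1`, `b = 2`, `c = 3` hold.
[cite: CohnKleinbergSzegedyUmans2005, §6.1 (p. 10)] -/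
def localStrongUSPPatterns : Finset (Fin 3 × Fin 3 × Fin 3) :=
  {((0 : Fin 3), (1 : Fin 3), (0 : Fin 3)), (0, 1, 1), (0, 0, 2), (0, 2, 2), (1, 1, 2), (2, 1, 2)}

/-- **Local strong USP** (CKSU §6.1, p. 10) as a property of a family of `L` rows of width `k`
over the alphabet `Fin 3`: every ordered triple of rows with indices not all equal has a coordinate
whose pattern lies in `localStrongUSPPatterns`. (No constant triple is a pattern, so the condition
forces the rows to be pairwise distinct: the family is a set `U ⊆ {1,2,3}^k` with `|U| = L`.)
[cite: CohnKleinbergSzegedyUmans2005, §6.1 (p. 10)] -/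
def IsLocalStrongUSP {k L : ℕ} (row : Fin L → Fin k → Fin 3) : Prop :=
  ∀ a b c : Fin L, (a ≠ b ∨ b ≠ c) → ∃ i : Fin k, (row a i, row b i, row c i) ∈ localStrongUSPPatterns

/-- `A_u = {x ∈ Cyc_ℓ^k : x_j ≠ 0 iff u_j = 1}` (symbol `1` coded `0`).
[cite: CohnKleinbergSzegedyUmans2005, Thm. 33 (p. 10)] -/
def uspA (ℓ : ℕ) [NeZero ℓ] {k L : ℕ} (row : Fin L → Fin k → Fin 3) (a : Fin L) :
    Finset (Fin k → ZMod ℓ) :=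
  univ.filter fun x => ∀ j, x j ≠ 0 ↔ row a j = 0

/-- `B_u = {x ∈ Cyc_ℓ^k : x_j ≠ 0 iff u_j = 2}` (symbol `2` coded `1`).
[cite: CohnKleinbergSzegedyUmans2005, Thm. 33 (p. 10)] -/
def uspB (ℓ : ℕ) [NeZero ℓ] {k L : ℕ} (row : Fin L → Fin k → Fin 3) (a : Fin L) :
    Finset (Fin k → ZMod ℓ) :=
  univ.filter fun x => ∀ j, x j ≠ 0 ↔ row a j = 1

/-- `C_u = {x ∈ Cyc_ℓ^k : x_j ≠ 0 iff u_j = 3}` (symbol `3` coded `2`).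
[cite: CohnKleinbergSzegedyUmans2005, Thm. 33 (p. 10)] -/
def uspC (ℓ : ℕ) [NeZero ℓ] {k L : ℕ} (row : Fin L → Fin k → Fin 3) (a : Fin L) :
    Finset (Fin k → ZMod ℓ) :=
  univ.filter fun x => ∀ j, x j ≠ 0 ↔ row a j = 2

/-- **Cohn–Kleinberg–Szegedy–Umans 2005, Theorem 33** (AS PRINTED, p. 10): "Let `U` be a local
strong USP of width `k`, and for each `u ∈ U` define subsets `A_u, B_u, C_u ⊆ Cyc_ℓ^k` by
`A_u = {x : x_j ≠ 0 iff u_j = 1}`, `B_u = {x : x_j ≠ 0 iff u_j = 2}`, `C_u = {x : x_j ≠ 0 iff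
u_j = 3}`. Then the triples `A_u, B_u, C_u` satisfy the simultaneous triple product property." —
for every `ℓ ≥ 1` (`Cyc_ℓ = ZMod ℓ`), every width `k` and every local strong USP of `L` rows, the
family `(uspA, uspB, uspC)` is an STPP construction (`IsSTPP`, CKSU Def. 5.1 / BCCGNSU Def. 2.2 in
the tree's additive form) in the abelian group `Fin k → ZMod ℓ`. Named fact; grounds
`Summit.MatrixMultiplication.MatrixMultiplication.Theses.ThinBlockAlpha.USPToBounded`.
[cite: CohnKleinbergSzegedyUmans2005, Thm. 33 (p. 10)] -/
def CohnKleinbergSzegedyUmans2005_thm33 : Prop :=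
  ∀ (ℓ : ℕ) [NeZero ℓ] (k L : ℕ) (row : Fin L → Fin k → Fin 3), IsLocalStrongUSP row →
    IsSTPP (uspA ℓ row) (uspB ℓ row) (uspC ℓ row)

/-- Unfolding lemma: membership in `uspA`. [cite: CohnKleinbergSzegedyUmans2005, Thm. 33 (p. 10)] -/
theorem mem_uspA_iff (ℓ : ℕ) [NeZero ℓ] {k L : ℕ} (row : Fin L → Fin k → Fin 3) (a : Fin L)
    (x : Fin k → ZMod ℓ) : x ∈ uspA ℓ row a ↔ ∀ j, x j ≠ 0 ↔ row a j = 0 := by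
  simp [uspA]

/-- Unfolding lemma: membership in `uspB`. [cite: CohnKleinbergSzegedyUmans2005, Thm. 33 (p. 10)] -/
theorem mem_uspB_iff (ℓ : ℕ) [NeZero ℓ] {k L : ℕ} (row : Fin L → Fin k → Fin 3) (a : Fin L)
    (x : Fin k → ZMod ℓ) : x ∈ uspB ℓ row a ↔ ∀ j, x j ≠ 0 ↔ row a j = 1 := by
  simp [uspB]

/-- Unfolding lemma: membership in `uspC`. [cite: CohnKleinbergSzegedyUmans2005, Thm. 33 (p. 10)] -/
theorem mem_uspC_iff (ℓ : ℕ) [NeZero ℓ] {k L : ℕ} (row : Fin L → Fin k → Fin 3) (a : Fin L)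
    (x : Fin k → ZMod ℓ) : x ∈ uspC ℓ row a ↔ ∀ j, x j ≠ 0 ↔ row a j = 2 := by
  simp [uspC]

/-- Sanity check of the pattern set: a triple is admissible iff exactly two of
`a = 0`, `b = 1`, `c = 2` hold (CKSU's "exactly two of `(π₁u)ᵢ = 1`, `(π₂u)ᵢ = 2`, `(π₃u)ᵢ = 3`").
[cite: CohnKleinbergSzegedyUmans2005, §6.1 (p. 10)] -/
theorem mem_localStrongUSPPatterns_iff (a b c : Fin 3) :
    (a, b, c) ∈ localStrongUSPPatterns ↔
      ((a = 0 ∧ b = 1 ∧ c ≠ 2) ∨ (a = 0 ∧ b ≠ 1 ∧ c = 2) ∨ (a ≠ 0 ∧ b = 1 ∧ c = 2)) := by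
  simp only [localStrongUSPPatterns, Finset.mem_insert, Finset.mem_singleton, Prod.mk.injEq]
  revert a b c
  decide

/-- A local strong USP has pairwise distinct rows (no constant triple is an admissible pattern).
[cite: CohnKleinbergSzegedyUmans2005, §6.1 (p. 10)] -/
theorem IsLocalStrongUSP.injective {k L : ℕ} {row : Fin L → Fin k → Fin 3}
    (h : IsLocalStrongUSP row) : Function.Injective row := by
  intro a b hab
  by_contra hne
  obtain ⟨i, hi⟩ := h a b b (Or.inl hne)
  rw [hab] at hi
  rw [mem_localStrongUSPPatterns_iff] at hi
  rcases hi with ⟨h0, h1, _⟩ | ⟨h0, _, h2⟩ | ⟨_, h1, h2⟩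
  · rw [h0] at h1; exact absurd h1 (by decide)
  · rw [h0] at h2; exact absurd h2 (by decide)
  · rw [h1] at h2; exact absurd h2 (by decide)

/-! ### Proof of Theorem 33

Formalization of the printed proof [cite: CohnKleinbergSzegedyUmans2005, Thm. 33 (p. 10), proof]:
(1) simultaneity — for indices not all equal, the local strong USP coordinate `c` of the ordered
triple `(j, k, i)` makes exactly one of the six group elements of the STPP relation nonzero at `c`,
so the relation `(s' - s) + (t' - t) + (u' - u) = 0` fails at `c`; (2) the triple product property
of each single triple `(A_u, B_u, C_u)` — the three sets are supported on the pairwise disjoint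
coordinate sets `{u_c = 1}`, `{u_c = 2}`, `{u_c = 3}`, so the relation splits letter by letter. -/

/-- Every element of `Fin 3` is `0`, `1` or `2`. [folklore] -/
private theorem fin3_cases (a : Fin 3) : a = 0 ∨ a = 1 ∨ a = 2 := by
  revert a
  decide

/-- **Cohn–Kleinberg–Szegedy–Umans 2005, Theorem 33** (p. 10), proved: for every `ℓ ≥ 1`, every
width `k` and every local strong USP `row` of `L` rows, the family `(uspA ℓ row, uspB ℓ row,
uspC ℓ row)` satisfies the simultaneous triple product property in `Cyc_ℓ^k = Fin k → ZMod ℓ`.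
The proof follows the printed one verbatim (see the section docstring above).
[cite: CohnKleinbergSzegedyUmans2005, Thm. 33 (p. 10)] -/
theorem CohnKleinbergSzegedyUmans2005_thm33_holds : CohnKleinbergSzegedyUmans2005_thm33 := by
  intro ℓ _ k L row hU i j kk s hs s' hs' t ht t' ht' u hu u' hu' hsum
  rw [mem_uspA_iff] at hs hs'
  rw [mem_uspB_iff] at ht ht'
  rw [mem_uspC_iff] at hu hu'
  -- the relation, coordinate by coordinate
  have hc : ∀ c : Fin k, s' c - s c + (t' c - t c) + (u' c - u c) = 0 := fun c => by
    have e := congrFun hsum c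
    simpa only [Pi.add_apply, Pi.sub_apply, Pi.zero_apply] using e
  -- (1) simultaneity: the indices are all equal
  have hijk : i = j ∧ j = kk := by
    by_contra hne
    have hne' : j ≠ kk ∨ kk ≠ i := by
      rcases eq_or_ne j kk with hjk | hjk
      · right
        intro hki
        exact hne ⟨by rw [← hki, ← hjk], hjk⟩
      · exact Or.inl hjk
    -- the local strong USP coordinate of the ordered triple `(j, kk, i)`
    obtain ⟨c, hpat⟩ := hU j kk i hne'
    have h1 := hs c
    have h2 := hs' c
    have h3 := ht c
    have h4 := ht' c
    have h5 := hu c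
    have h6 := hu' c
    have e := hc c
    simp only [localStrongUSPPatterns, Finset.mem_insert, Finset.mem_singleton, Prod.mk.injEq]
      at hpat
    -- in each of the six patterns exactly one of the six terms is nonzero at `c`
    rcases hpat with ⟨hj, hk, hi⟩ | ⟨hj, hk, hi⟩ | ⟨hj, hk, hi⟩ | ⟨hj, hk, hi⟩ | ⟨hj, hk, hi⟩ |
        ⟨hj, hk, hi⟩ <;>
      simp only [hj, hk, hi, Fin.isValue, Fin.reduceEq, iff_true, iff_false, ne_eq,
        not_not] at h1 h2 h3 h4 h5 h6 <;>
      simp only [h1, h2, h3, h4, h5, h6, sub_zero, zero_sub, add_zero, zero_add, neg_eq_zero,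
        sub_self] at e
  -- (2) the triple product property of the single triple `(A_u, B_u, C_u)`, `u = row i`
  obtain ⟨hij, hjk⟩ := hijk
  subst kk
  subst j
  refine ⟨rfl, rfl, ?_, ?_, ?_⟩ <;> funext c <;> rcases fin3_cases (row i c) with h | h | h <;>
  ( have h1 := hs c
    have h2 := hs' c
    have h3 := ht c
    have h4 := ht' c
    have h5 := hu c
    have h6 := hu' c
    have e := hc c
    simp only [h, Fin.isValue, Fin.reduceEq, iff_true, iff_false, ne_eq, not_not]
      at h1 h2 h3 h4 h5 h6
    first
      | rw [h1, h2]
      | rw [h3, h4]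
      | rw [h5, h6]
      | (simp only [h1, h2, h3, h4, h5, h6, add_zero, zero_add, sub_self, sub_eq_zero] at e
         exact e.symm) )

end Literature.Computability.AlgebraicComplexity
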